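import Summits.HodgeConjecture.HodgeConjecture.Theses.SupersingularIsotypicLift
import Summits.HodgeConjecture.HodgeConjecture.Theses.PeriodDeficiency
import Summits.HodgeConjecture.HodgeConjecture.Theorems.LinearSystemTorelliMiddleDivisorSupportFourfoldStubFiniteMonodromyOfTypeStability
import Literature.AlgebraicGeometry.HodgeTheory.SpreadingOutQbarFamilyProofs
import Literature.AlgebraicGeometry.HodgeTheory.IsoTransport

/-!
# Line `qbar_descent` — crux `IsotypicClassesAlgebraic` (LIFT) of route `SupersingularIsotypicLift`

Crux item `stmt-HodgeConjecture-3048`, decl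
`Summit.HodgeConjecture.HodgeConjecture.Theses.SupersingularIsotypicLift.IsotypicClassesAlgebraic`
(LIFT): a RATIONAL class `c` fixed by a rational algebraic self-correspondence action `P = P_γ`
(`γ ∈ algebraicClasses (X ⊗ X) n`, `P` preserving rational classes, `Im P ⊂ H^{p,p}`) on a smooth
projective complex `X` is algebraic.

## The line (TRANSFER lens: LIFT ⟸ HC over `ℚ̄`, via a PROVABLE envelope ⇒ type-stability lemma)

Strategist's alternative to the André seam of `Lines/birth.lean` (enveloped ⇒ motivated ∧ `B`).
Spread `X` out over `ℚ̄` (`spreadingOut_smoothProjective_qbarFamily_holds`, PROVED: `e : X ≅ 𝒳_s`,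
`s` over the generic point of a smooth irreducible quasi-projective `ℚ̄`-base `S₀`). Voisin's
finite-monodromy mechanism (2007, §3, proof of Prop. 1.7 = the tree's named fact
`voisin2007_algebraic_of_finite_monodromyOrbit_of_qbar`, carried as the EXISTING route item
`PeriodDeficiency.FiniteMonodromyAlgebraicOfQbar`, stmt-15380) says: a rational `(p,p)` class on
`𝒳_s` with FINITE monodromy orbit is algebraic as soon as Hodge classes on smooth projective
`ℚ̄`-varieties are (`PeriodDeficiency.HodgeConjectureQbar`, stmt-11596). Finite orbit follows,
UNCONDITIONALLY and in the tree (`linearSystemTorelli_finite_setOf_isContinuationAlong_of_forall_isOfHodgeType`,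
Cattani–Deligne–Kaplan §1 / Baldi–Klingler–Ullmo §3.2: lattice + definite flat polarization),
from TYPE STABILITY: every flat continuation of the class along a loop at `s` is again of type
`(p,p)`. For a GENERAL Hodge class type stability at the `ℚ̄`-generic point is the open transcendence
kernel of the `ℚ̄`-anchored routes (`Envelope` line `birth`, stub T; `PeriodDeficiency.QbarGenericIsHodgeGeneric`
= Klingler–Otwinowska–Urbanik Conj. 1.5(a)). THE POINT OF THIS LINE: for an ENVELOPED class it is a
LEMMA —

* `stub_envelopedTypeStableAtQbarGeneric` (the engine; NEW, provable): the correspondence class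
  `γ` is, up to homological equivalence, the class of a `ℚ`-cycle `Z` defined over a finite extension
  `L` of the function field `κ(η) = ℚ̄(S₀) ↪ ℂ` of the base (Chow varieties of `X_η²` are defined over
  `κ(η)`; cycles in one component are algebraically, hence homologically, equivalent), so `Z` SPREADS
  to a relative cycle `𝒵` over a finite étale cover `U₁ → U` of a dense open `U ⊆ S₀`; the conjugate
  actions `P_g = [g^*𝒵]_*` (`g ∈ Gal`) are FLAT endomorphisms of `R²ᵖπ_*ℚ|_{U₁}`, each with `(p,p)`
  image at the points over `s` (the condition "`P` kills `F^{p+1}H_dR`" is algebraic de Rham data over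
  `κ(η)`, transported by `Aut(ℂ/κ(η))`; the conjugate condition follows by reality of `P_g`), so
  `M := Σ_g Im P_g` descends to a sub-local system of `R²ᵖπ_*ℚ|_U` whose fibre at `s` consists of
  `(p,p)`-classes and contains `c = P c`; since `π₁(U(ℂ), s) ↠ π₁(S₀(ℂ), s)` (smooth irreducible base)
  and `R²ᵖπ_*ℚ` lives on all of `S₀(ℂ)`, `M_s` is `π₁(S₀(ℂ), s)`-stable: every loop-continuation of
  `c` stays in `M_s ⊂ H^{p,p}`. Equivalently: the Hodge locus of an enveloped class through the
  `ℚ̄`-generic point is EVERYTHING — Voisin's "dark case" (an isolated point of the Hodge locus at a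
  transcendental parameter) cannot occur for enveloped classes.
* `stub_finiteMonodromyAlgebraicOfQbar` = `PeriodDeficiency.FiniteMonodromyAlgebraicOfQbar` BY NAME
  (stmt-15380; TRUE in print — Voisin 2007 §3 / Charles–Schnell Thm. 11.3.19; in the tree proved modulo
  classical leaves: Riemann existence + `ℚ̄`-descent of finite étale covers, Deligne's global invariant
  cycle theorem stmt-16363, strong Hironaka over `ℚ̄`, Fulton 19.2 pull-back).
* `stub_hodgeConjectureQbar` = `PeriodDeficiency.HodgeConjectureQbar` BY NAME (stmt-11596; OPEN — the
  TRANSFER TARGET C⁺: over `ℚ̄` the enveloped piece acquires an algebraic de Rham incarnation inside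
  `Fᵖ`, crystalline Frobenii at all good primes with Newton slope forced `= p` (Mazur–Katz) hence
  eigenvalues `qᵖ·ζ` (Kronecker), one ℓ-adic Galois representation — Tate / Mumford–Tate / the route's
  own p-adic lifting (BEK + ALG, which NEEDS a model over a number ring) apply there and only there).

`IsotypicClassesAlgebraic_of : Sig.stub_envelopedTypeStableAtQbarGeneric →
PeriodDeficiency.FiniteMonodromyAlgebraicOfQbar → PeriodDeficiency.HodgeConjectureQbar →
IsotypicClassesAlgebraic` is a REAL proof (spread, transport `c` to `α := (e⁻¹)^* c` on `𝒳_s`,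
finite orbit from type stability, Voisin's mechanism fed with HC(`ℚ̄`), transport back along `e`);
`IsotypicClassesAlgebraic_of_stubs` instantiates it at the three sorried stubs.

No stub gives the crux or the summit alone: stub 1 only says loop-continuations stay `(p,p)`; stub 2
is an implication with HC(`ℚ̄`) as antecedent; stub 3 is HC restricted to `ℚ̄`-definable varieties
(`PeriodDeficiency.closes` needs `QbarGenericIsHodgeGeneric` besides). Disproof used: none exists for
this crux (`ledger crux ls`: no `Disproof.lean`). Dead lines: none recorded.
-/

-- every declaration of this problem lives in `Summit.HodgeConjecture.HodgeConjecture.…`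
set_option linter.dupNamespace false

namespace Summit.HodgeConjecture.HodgeConjecture.Cruxes.IsotypicClassesAlgebraic.QbarDescent

open CategoryTheory AlgebraicGeometry Topology
open Literature.AlgebraicGeometry Literature.AlgebraicGeometry.Motives
open Literature.AlgebraicGeometry.HodgeTheory
open Literature.AlgebraicTopology.SingularHomology
open Summit.HodgeConjecture.HodgeConjecture.Theses.SupersingularIsotypicLift
open Summit.HodgeConjecture.HodgeConjecture.Theses

/-- **Stub 1 statement — ENVELOPED CLASSES ARE TYPE-STABLE AT THE `ℚ̄`-GENERIC POINT (the engine).**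
For `σ : ℚ̄ →+* ℂ`, a `ℚ̄`-morphism `f₀ : 𝒳₀ ⟶ S₀` of quasi-projective `ℚ̄`-schemes with `S₀` smooth
irreducible whose complexification is a smooth projective family of relative dimension `n`, a complex
point `s` over the GENERIC point of `S₀`, an identification `e : X ≅ 𝒳_s` of a smooth projective `X`,
and the crux's data VERBATIM on `X` (orientation family `μ` with Poincaré duality, `p`,
`γ ∈ algebraicClasses (X ⊗ X) n`, the inlined action `P β = pr₁₊(pr₂*β ∪ γ)`, `P` preserving rational
classes and `(p,p)`-imaged, `c` rational with `P c = c`): every flat continuation `β` of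
`(e⁻¹)^* c` along a loop at `s` is of Hodge type `(p,p)` on `𝒳_s`.  Why true (paper proof in the
module docstring): the correspondence spreads, after descent of its class to `κ(η)^alg` and a finite
étale cover of a dense open of `S₀`, to flat endomorphisms whose conjugate images form a
`π₁(S₀(ℂ), s)`-stable space of `(p,p)`-classes containing `c`. [cite: Voisin2007HodgeLoci, §3, proof of Prop. 1.7]
[cite: CharlesSchnell2014Notes, §11.3.5 and Thm. 11.3.19] -/
def Sig.stub_envelopedTypeStableAtQbarGeneric : Prop :=
  ∀ (σ : AlgebraicClosure ℚ →+* ℂ) ⦃𝒳₀ S₀ : Literature.AlgebraicGeometry.Motives.SchemeOver (AlgebraicClosure ℚ)⦄ (f₀ : 𝒳₀ ⟶ S₀) (n : ℕ), Literature.AlgebraicGeometry.HodgeTheory.IsQuasiProjectiveOver 𝒳₀ → Literature.AlgebraicGeometry.HodgeTheory.IsQuasiProjectiveOver S₀ → IrreducibleSpace S₀.left → AlgebraicGeometry.Smooth S₀.hom → Literature.AlgebraicGeometry.Motives.IsSmoothProjectiveFamily ((Literature.AlgebraicGeometry.Motives.baseChangeHom σ).map f₀) n → ∀ (s : Literature.AlgebraicGeometry.Motives.ComplexPoints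 ((Literature.AlgebraicGeometry.Motives.baseChangeHom σ).obj S₀)), closure {(Literature.AlgebraicGeometry.Motives.baseChangeHomFst σ S₀).base s.pt} = (Set.univ : Set S₀.left) → ∀ (μ : Literature.AlgebraicGeometry.HodgeTheory.OrientationFamily), μ.HasPoincareDuality → ∀ ⦃X : Literature.AlgebraicGeometry.Motives.SchemeOver ℂ⦄ (hX : Literature.AlgebraicGeometry.Motives.IsSmoothProjective n X) (e : X ≅ Literature.AlgebraicGeometry.Motives.fiberOver ((Literature.AlgebraicGeometry.Motives.baseChangeHom σ).map f₀) s) (p : ℕ) (γ : Literature.AlgebraicGeometry.HodgeTheory.complexBetti (CategoryTheory.MonoidalCategoryStruct.tensorObj X X) (2 * n)), γ ∈ Literature.AlgebraicGeometry.HodgeTheory.algebraicClasses (CategoryTheory.MonoidalCategoryStruct.tensorObj X X) n → let P : Literature.AlgebraicGeometry.HodgeTheory.complexBetti X (2 * p) → Literature.AlgebraicGeometry.HodgeTheory.complexBetti X (2 * p) := fun β => Literature.AlgebraicGeometry.HodgeTheory.complexGysin μ (Literature.AlgebraicGeometry.Motives.IsSmoothProjective.tensor_holds hX hX) hX (CategoryTheory.CartesianMonoidalCategory.fst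 X X) (show 2 * p + 2 * n + 2 * n = 2 * p + 2 * (n + n) by ring) (Literature.AlgebraicTopology.SingularHomology.cupProduct (rfl : 2 * p + 2 * n = 2 * p + 2 * n) (Literature.AlgebraicGeometry.HodgeTheory.complexBetti.map (CategoryTheory.CartesianMonoidalCategory.snd X X) (2 * p) β) γ); (∀ β, Literature.AlgebraicGeometry.HodgeTheory.IsRationalClass β → Literature.AlgebraicGeometry.HodgeTheory.IsRationalClass (P β)) → (∀ β, Literature.AlgebraicGeometry.HodgeTheory.IsOfHodgeType n X (2 * p) p p (P β)) → ∀ c, Literature.AlgebraicGeometry.HodgeTheory.IsRationalClass c → P c = c → ∀ (δ : Path s s) (β : Literature.AlgebraicGeometry.HodgeTheory.complexBetti (Literature.AlgebraicGeometry.Motives.fiberOver ((Literature.AlgebraicGeometry.Motives.baseChangeHom σ).map f₀) s) (2 * p)), Literature.AlgebraicGeometry.HodgeTheory.IsContinuationAlong δ (Literature.AlgebraicGeometry.HodgeTheory.complexBetti.map e.inv (2 * p) c) β → Literature.AlgebraicGeometry.HodgeTheory.IsOfHodgeType n (Literature.AlgebraicGeometry.Motives.fiberOver ((Literature.AlgebraicGeometry.Motives.baseChangeHom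 σ).map f₀) s) (2 * p) p p β

/-- Stub 1 (the engine, NEW; provable on paper): enveloped classes are type-stable along loops at the
`ℚ̄`-generic point of any `ℚ̄`-spread. [cite: Voisin2007HodgeLoci, §3, proof of Prop. 1.7] -/
theorem stub_envelopedTypeStableAtQbarGeneric : Sig.stub_envelopedTypeStableAtQbarGeneric := by
  sorry

/-- Stub 2 = the EXISTING item `PeriodDeficiency.FiniteMonodromyAlgebraicOfQbar` (stmt-15380) by name:
Voisin's finite-monodromy mechanism (finite orbit + HC(`ℚ̄`) ⟹ algebraic), true in print, formal debt
tracked on that item. Closes by `exact PeriodDeficiency.FiniteMonodromyAlgebraicOfQbar_holds` when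
stmt-15380 closes. [cite: Voisin2007HodgeLoci, §3, proof of Prop. 1.7] [cite: CharlesSchnell2014Notes, Thm. 11.3.19] -/
theorem stub_finiteMonodromyAlgebraicOfQbar : PeriodDeficiency.FiniteMonodromyAlgebraicOfQbar := by
  sorry

/-- Stub 3 = the EXISTING item `PeriodDeficiency.HodgeConjectureQbar` (stmt-11596) by name: the Hodge
conjecture for `ℚ̄`-definable smooth projective varieties `X₀ ⊗_σ ℂ` — OPEN; the transfer target of
the line (common target of the `ℚ̄`-anchored routes QbarEnvelope / PeriodDeficiency / PeriodsPolice /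
FiniteTreeOfFlavours). [cite: Voisin2007HodgeLoci, Prop. 1.2 and Prop. 1.7] -/
theorem stub_hodgeConjectureQbar : PeriodDeficiency.HodgeConjectureQbar := by
  sorry

/-- **Composition (real proof).** Spread `X` over `ℚ̄` (PROVED fact), move `c` to the fibre
`α := (e⁻¹)^* c` (rational, of type `(p,p)` since `c = P c`), get FINITE monodromy orbit from the
type stability of stub 1 by the tree's unconditional
`linearSystemTorelli_finite_setOf_isContinuationAlong_of_forall_isOfHodgeType`, feed Voisin's
mechanism (stub 2) with HC(`ℚ̄`) (stub 3), and transport algebraicity back along `e`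
(`mem_algebraicClasses_map_iff_of_iso`). Concludes the route decl `IsotypicClassesAlgebraic` BY NAME. -/
theorem IsotypicClassesAlgebraic_of :
    Sig.stub_envelopedTypeStableAtQbarGeneric → PeriodDeficiency.FiniteMonodromyAlgebraicOfQbar →
      PeriodDeficiency.HodgeConjectureQbar → IsotypicClassesAlgebraic := by
  intro hT hV hQ μ hμ n X hX p γ hγ P hrat hhodge c hc hfix
  -- an embedding `ℚ̄ →+* ℂ`
  obtain ⟨σ⟩ := exists_ringHom_algebraicClosure_rat_complex
  -- spread `X` out over `ℚ̄`: `e : X ≅ 𝒳_s`, `s` over the generic point of `S₀`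
  obtain ⟨𝒳₀, S₀, f₀, s, h𝒳₀, hS₀, hirr, hsm, hf, hgen, ⟨e⟩⟩ :=
    spreadingOut_smoothProjective_qbarFamily_holds σ hX
  -- `c = P c` is of type `(p,p)`
  have hcpp : IsOfHodgeType n X (2 * p) p p c := by
    have h := hhodge c
    rwa [hfix] at h
  -- the transported class on the fibre
  have hα : IsRationalClass (complexBetti.map e.inv (2 * p) c) := hc.map _
  have hαpp : IsOfHodgeType n (fiberOver ((baseChangeHom σ).map f₀) s) (2 * p) p p
      (complexBetti.map e.inv (2 * p) c) := hcpp.map_of_iso e.symm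
  -- type stability (stub 1) ⟹ finite monodromy orbit (PROVED in the tree)
  have hfin : {β : complexBetti (fiberOver ((baseChangeHom σ).map f₀) s) (2 * p) |
      ∃ δ : Path s s, IsContinuationAlong δ (complexBetti.map e.inv (2 * p) c) β}.Finite :=
    Theorems.linearSystemTorelli_finite_setOf_isContinuationAlong_of_forall_isOfHodgeType σ f₀ n p hf
      h𝒳₀ hS₀ hirr hsm s (complexBetti.map e.inv (2 * p) c) hα
      (fun δ β hβ => hT σ f₀ n h𝒳₀ hS₀ hirr hsm hf s hgen μ hμ hX e p γ hγ hrat hhodge c hc hfix δ β hβ)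
  -- Voisin's mechanism (stub 2) fed with HC(ℚ̄) (stub 3)
  have halg : complexBetti.map e.inv (2 * p) c ∈
      algebraicClasses (fiberOver ((baseChangeHom σ).map f₀) s) p :=
    hV σ f₀ n p h𝒳₀ hS₀ hirr hsm hf s (complexBetti.map e.inv (2 * p) c) hα hαpp hfin
      (fun m X₀ hX₀ q c' hc' hpp' => (hQ σ hX₀).2 q c' hc' hpp')
  -- back along `e`
  exact (mem_algebraicClasses_map_iff_of_iso e.symm).1 halg

/-- **The line concludes the crux** (the composition instantiated at the three declared stubs; `sorry`
occurs only inside `stub_envelopedTypeStableAtQbarGeneric`, `stub_finiteMonodromyAlgebraicOfQbar`,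
`stub_hodgeConjectureQbar`). -/
theorem IsotypicClassesAlgebraic_of_stubs : IsotypicClassesAlgebraic :=
  IsotypicClassesAlgebraic_of stub_envelopedTypeStableAtQbarGeneric stub_finiteMonodromyAlgebraicOfQbar
    stub_hodgeConjectureQbar

end Summit.HodgeConjecture.HodgeConjecture.Cruxes.IsotypicClassesAlgebraic.QbarDescent
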